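import Mathlib.Algebra.BigOperators.Intervals
import Mathlib.Algebra.BigOperators.Ring.Finset
import Mathlib.Algebra.BigOperators.Fin
import Mathlib.Algebra.GroupWithZero.Units.Basic
import Mathlib.Tactic.Ring
import Mathlib.Tactic.LinearCombination
import HarnessLib

/-!
# ζ(5) search — REPLAY KERNEL for creative-telescoping certificates (cell `pub-zeta5`, certifier `cert-1`)

HONEST FRAMING: systematic search; no irrationality claim unless certified.

A recurrence certificate for a definite hypergeometric sum `u(n) = Σ_k F(n,k)` as delivered by a
telescoper (Zeilberger 1991 / Chyzak / Koutschan `HolonomicFunctions` / the hub's `exactrec`) is a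
pair (TELESCOPER `P₀(n),…,P_r(n)`, CERTIFICATE `R(n,k)`) with the TERMWISE identity

  `Σ_i P_i(n) F(n+i,k) = G(n,k+1) − G(n,k)`,  `G = R·F`.

"Replaying" it in the kernel has three steps, of which this file supplies the last, generically, once
and for all (the first two are family-specific and live in `Certificates/<Family>.lean`):

1. CLEARED IDENTITY — divide the termwise identity by a common hypergeometric unit `β(n,k)`: what is
   left is a POLYNOMIAL identity in `n, k` (and the family's parameters), closed by `ring`;
2. RE-ATTACH THE TERM — binomial/Pochhammer ratio lemmas `Z(n)·F(n+i,k+j) = β(n,k)·poly` turn the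
   cleared identity back into the termwise one (pattern: `SymmetricFamilyRecursion.Zn_outerS_*`,
   `WedgeDictionaryLevelDescentVFullRecKInterior.wzUnit`);
3. SUM (this file) — `sum_mul_sum_eq_of_telescope` and its fixed-arity forms `telescope₂/₃/₄`
   (order 1/2/3 telescopers): the sum of the termwise identity over `k < M` is
   `Σ_i P_i · Σ_{k<M} F_i(k) = G(M) − G(0)`; with NATURAL BOUNDARIES (`G(0) = 0 = G(M)`, the
   `…_eq_zero` forms) this is the recurrence `Σ_i P_i(n) u(n+i) = 0` after the support of each
   `F(n+i,·)` is truncated to `k < M` (`sum_range_eq_of_vanish`). Double sums with two certificates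
   (Apagodu–Zeilberger / Chyzak shape `Σ_i P_i F_i = Δ_{k₁}G₁ + Δ_{k₂}G₂`): `double_telescope`.
   Identification of a replayed sum with a sequence already in the tree (same recurrence, same
   initial values): `eq_of_rec₂` / `eq_of_rec₃` (leading coefficient non-vanishing).

Everything is over an arbitrary commutative ring (`ℚ`, `ℚ(a)`, polynomial rings of parameters).
Calibration instance: `Certificates/Apery.lean`. No named facts; nothing here is specific to ζ(5).
-/

namespace Summit.KontsevichZagierPeriods.Zeta5Search.Certificates

open Finset

variable {R : Type*} [CommRing R]

/-! ### Step 3a — summing a termwise certificate identity -/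

/-- **Creative telescoping, summed (general arity).** If termwise `Σ_i P_i · F_i(k) = G(k+1) − G(k)`
for all `k < M`, then `Σ_i P_i · (Σ_{k<M} F_i(k)) = G(M) − G(0)`. -/
theorem sum_mul_sum_eq_of_telescope {ι : Type*} (s : Finset ι) (P : ι → R) (F : ι → ℕ → R)
    (G : ℕ → R) (M : ℕ) (h : ∀ k, k < M → ∑ i ∈ s, P i * F i k = G (k + 1) - G k) :
    ∑ i ∈ s, P i * ∑ k ∈ range M, F i k = G M - G 0 := by
  calc ∑ i ∈ s, P i * ∑ k ∈ range M, F i k = ∑ k ∈ range M, ∑ i ∈ s, P i * F i k := by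
        simp only [Finset.mul_sum]; exact Finset.sum_comm
    _ = ∑ k ∈ range M, (G (k + 1) - G k) :=
        Finset.sum_congr rfl fun k hk => h k (mem_range.1 hk)
    _ = G M - G 0 := Finset.sum_range_sub G M

/-- Natural boundaries, general arity: if moreover `G(0) = 0` and `G(M) = 0` then
`Σ_i P_i · (Σ_{k<M} F_i(k)) = 0`. -/
theorem sum_mul_sum_eq_zero_of_telescope {ι : Type*} (s : Finset ι) (P : ι → R) (F : ι → ℕ → R)
    (G : ℕ → R) (M : ℕ) (h : ∀ k, k < M → ∑ i ∈ s, P i * F i k = G (k + 1) - G k)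
    (h0 : G 0 = 0) (hM : G M = 0) :
    ∑ i ∈ s, P i * ∑ k ∈ range M, F i k = 0 := by
  rw [sum_mul_sum_eq_of_telescope s P F G M h, h0, hM, sub_zero]

/-- **Order-1 telescoper** (two shifts; also the plain WZ/Gosper case with `P₁ = -P₀`):
`P₀ F₀(k) + P₁ F₁(k) = G(k+1) − G(k)` for `k < M` gives
`P₀ Σ_{k<M} F₀ + P₁ Σ_{k<M} F₁ = G(M) − G(0)`. -/
theorem telescope₂ (P₀ P₁ : R) (F₀ F₁ : ℕ → R) (G : ℕ → R) (M : ℕ)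
    (h : ∀ k, k < M → P₀ * F₀ k + P₁ * F₁ k = G (k + 1) - G k) :
    P₀ * ∑ k ∈ range M, F₀ k + P₁ * ∑ k ∈ range M, F₁ k = G M - G 0 := by
  have hs : ∀ k, k < M → ∑ i ∈ (univ : Finset (Fin 2)), ![P₀, P₁] i * ![F₀, F₁] i k = G (k + 1) - G k := by
    intro k hk; rw [Fin.sum_univ_two]; simpa using h k hk
  have := sum_mul_sum_eq_of_telescope univ ![P₀, P₁] ![F₀, F₁] G M hs
  rw [Fin.sum_univ_two] at this
  simpa using this

/-- **Order-2 telescoper** (three shifts `F₀, F₁, F₂ = F(n,·), F(n+1,·), F(n+2,·)`):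
termwise `P₀F₀ + P₁F₁ + P₂F₂ = G(k+1) − G(k)` for `k < M` gives
`P₀ ΣF₀ + P₁ ΣF₁ + P₂ ΣF₂ = G(M) − G(0)` (sums over `k < M`). -/
theorem telescope₃ (P₀ P₁ P₂ : R) (F₀ F₁ F₂ : ℕ → R) (G : ℕ → R) (M : ℕ)
    (h : ∀ k, k < M → P₀ * F₀ k + P₁ * F₁ k + P₂ * F₂ k = G (k + 1) - G k) :
    P₀ * ∑ k ∈ range M, F₀ k + P₁ * ∑ k ∈ range M, F₁ k + P₂ * ∑ k ∈ range M, F₂ k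
      = G M - G 0 := by
  have hs : ∀ k, k < M →
      ∑ i ∈ (univ : Finset (Fin 3)), ![P₀, P₁, P₂] i * ![F₀, F₁, F₂] i k = G (k + 1) - G k := by
    intro k hk; rw [Fin.sum_univ_three]; simpa [add_assoc] using h k hk
  have := sum_mul_sum_eq_of_telescope univ ![P₀, P₁, P₂] ![F₀, F₁, F₂] G M hs
  rw [Fin.sum_univ_three] at this
  simpa [add_assoc] using this

/-- Order-2 telescoper with natural boundaries: `… = 0` when `G(0) = G(M) = 0`. -/
theorem telescope₃_eq_zero (P₀ P₁ P₂ : R) (F₀ F₁ F₂ : ℕ → R) (G : ℕ → R) (M : ℕ)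
    (h : ∀ k, k < M → P₀ * F₀ k + P₁ * F₁ k + P₂ * F₂ k = G (k + 1) - G k)
    (h0 : G 0 = 0) (hM : G M = 0) :
    P₀ * ∑ k ∈ range M, F₀ k + P₁ * ∑ k ∈ range M, F₁ k + P₂ * ∑ k ∈ range M, F₂ k = 0 := by
  rw [telescope₃ P₀ P₁ P₂ F₀ F₁ F₂ G M h, h0, hM, sub_zero]

/-- **Order-3 telescoper** (four shifts — the shape of every known ζ(5) recursion):
termwise `P₀F₀ + P₁F₁ + P₂F₂ + P₃F₃ = G(k+1) − G(k)` for `k < M` gives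
`P₀ ΣF₀ + P₁ ΣF₁ + P₂ ΣF₂ + P₃ ΣF₃ = G(M) − G(0)` (sums over `k < M`). -/
theorem telescope₄ (P₀ P₁ P₂ P₃ : R) (F₀ F₁ F₂ F₃ : ℕ → R) (G : ℕ → R) (M : ℕ)
    (h : ∀ k, k < M → P₀ * F₀ k + P₁ * F₁ k + P₂ * F₂ k + P₃ * F₃ k = G (k + 1) - G k) :
    P₀ * ∑ k ∈ range M, F₀ k + P₁ * ∑ k ∈ range M, F₁ k + P₂ * ∑ k ∈ range M, F₂ k
        + P₃ * ∑ k ∈ range M, F₃ k = G M - G 0 := by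
  have hs : ∀ k, k < M → ∑ i ∈ (univ : Finset (Fin 4)),
      ![P₀, P₁, P₂, P₃] i * ![F₀, F₁, F₂, F₃] i k = G (k + 1) - G k := by
    intro k hk; rw [Fin.sum_univ_four]; simpa [add_assoc] using h k hk
  have := sum_mul_sum_eq_of_telescope univ ![P₀, P₁, P₂, P₃] ![F₀, F₁, F₂, F₃] G M hs
  rw [Fin.sum_univ_four] at this
  simpa [add_assoc] using this

/-- Order-3 telescoper with natural boundaries: `… = 0` when `G(0) = G(M) = 0`. -/
theorem telescope₄_eq_zero (P₀ P₁ P₂ P₃ : R) (F₀ F₁ F₂ F₃ : ℕ → R) (G : ℕ → R) (M : ℕ)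
    (h : ∀ k, k < M → P₀ * F₀ k + P₁ * F₁ k + P₂ * F₂ k + P₃ * F₃ k = G (k + 1) - G k)
    (h0 : G 0 = 0) (hM : G M = 0) :
    P₀ * ∑ k ∈ range M, F₀ k + P₁ * ∑ k ∈ range M, F₁ k + P₂ * ∑ k ∈ range M, F₂ k
        + P₃ * ∑ k ∈ range M, F₃ k = 0 := by
  rw [telescope₄ P₀ P₁ P₂ P₃ F₀ F₁ F₂ F₃ G M h, h0, hM, sub_zero]

/-! ### Step 3b — truncating a natural-boundary sum to a common range -/

/-- If `f k = 0` for `k ≥ m` then `Σ_{k<M} f k = Σ_{k<m} f k` for every `M ≥ m` (used to bring the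
shifted sums `Σ_{k≤n+i} F(n+i,k)` to one common range before telescoping). -/
theorem sum_range_eq_of_vanish (f : ℕ → R) {m M : ℕ} (hmM : m ≤ M) (hf : ∀ k, m ≤ k → f k = 0) :
    ∑ k ∈ range M, f k = ∑ k ∈ range m, f k := by
  symm
  apply Finset.sum_subset
  · intro k hk
    simp only [mem_range] at hk ⊢
    omega
  · intro k _ hk
    simp only [mem_range, not_lt] at hk
    exact hf k hk

/-! ### Step 3c — double sums with two certificates -/

/-- **Double-sum creative telescoping** (Apagodu–Zeilberger / Chyzak shape): if termwise
`Σ_i P_i F_i(k₁,k₂) = (G₁(k₁+1,k₂) − G₁(k₁,k₂)) + (G₂(k₁,k₂+1) − G₂(k₁,k₂))` on the box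
`k₁ < M₁, k₂ < M₂`, then `Σ_i P_i Σ_{k₁<M₁} Σ_{k₂<M₂} F_i = Σ_{k₂<M₂}(G₁(M₁,k₂) − G₁(0,k₂)) +
Σ_{k₁<M₁}(G₂(k₁,M₂) − G₂(k₁,0))` (the two boundary sums; zero for natural boundaries). -/
theorem double_telescope {ι : Type*} (s : Finset ι) (P : ι → R) (F : ι → ℕ → ℕ → R)
    (G₁ G₂ : ℕ → ℕ → R) (M₁ M₂ : ℕ)
    (h : ∀ k₁, k₁ < M₁ → ∀ k₂, k₂ < M₂ →
      ∑ i ∈ s, P i * F i k₁ k₂ = (G₁ (k₁ + 1) k₂ - G₁ k₁ k₂) + (G₂ k₁ (k₂ + 1) - G₂ k₁ k₂)) :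
    ∑ i ∈ s, P i * ∑ k₁ ∈ range M₁, ∑ k₂ ∈ range M₂, F i k₁ k₂
      = ∑ k₂ ∈ range M₂, (G₁ M₁ k₂ - G₁ 0 k₂) + ∑ k₁ ∈ range M₁, (G₂ k₁ M₂ - G₂ k₁ 0) := by
  calc ∑ i ∈ s, P i * ∑ k₁ ∈ range M₁, ∑ k₂ ∈ range M₂, F i k₁ k₂
      = ∑ k₁ ∈ range M₁, ∑ k₂ ∈ range M₂, ∑ i ∈ s, P i * F i k₁ k₂ := by
        simp only [Finset.mul_sum]
        rw [Finset.sum_comm]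
        exact Finset.sum_congr rfl fun _ _ => Finset.sum_comm
    _ = ∑ k₁ ∈ range M₁, ∑ k₂ ∈ range M₂,
          ((G₁ (k₁ + 1) k₂ - G₁ k₁ k₂) + (G₂ k₁ (k₂ + 1) - G₂ k₁ k₂)) :=
        Finset.sum_congr rfl fun k₁ hk₁ => Finset.sum_congr rfl fun k₂ hk₂ =>
          h k₁ (mem_range.1 hk₁) k₂ (mem_range.1 hk₂)
    _ = ∑ k₁ ∈ range M₁, ((∑ k₂ ∈ range M₂, (G₁ (k₁ + 1) k₂ - G₁ k₁ k₂))
          + ∑ k₂ ∈ range M₂, (G₂ k₁ (k₂ + 1) - G₂ k₁ k₂)) :=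
        Finset.sum_congr rfl fun _ _ => Finset.sum_add_distrib
    _ = ∑ k₁ ∈ range M₁, ∑ k₂ ∈ range M₂, (G₁ (k₁ + 1) k₂ - G₁ k₁ k₂)
          + ∑ k₁ ∈ range M₁, ∑ k₂ ∈ range M₂, (G₂ k₁ (k₂ + 1) - G₂ k₁ k₂) :=
        Finset.sum_add_distrib
    _ = ∑ k₂ ∈ range M₂, ∑ k₁ ∈ range M₁, (G₁ (k₁ + 1) k₂ - G₁ k₁ k₂)
          + ∑ k₁ ∈ range M₁, (G₂ k₁ M₂ - G₂ k₁ 0) := by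
        rw [Finset.sum_comm]
        congr 1
        exact Finset.sum_congr rfl fun k₁ _ => Finset.sum_range_sub (fun k₂ => G₂ k₁ k₂) M₂
    _ = ∑ k₂ ∈ range M₂, (G₁ M₁ k₂ - G₁ 0 k₂) + ∑ k₁ ∈ range M₁, (G₂ k₁ M₂ - G₂ k₁ 0) := by
        congr 1
        exact Finset.sum_congr rfl fun k₂ _ => Finset.sum_range_sub (fun k₁ => G₁ k₁ k₂) M₁

/-! ### Identification: a P-recursive sequence is determined by its recurrence and initial values -/

/-- **Uniqueness for order 2.** Two sequences solving `a(n) y(n+2) = b(n) y(n+1) + c(n) y(n)` with a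
non-vanishing (regular) leading coefficient and the same two initial values coincide. -/
theorem eq_of_rec₂ [NoZeroDivisors R] {u v : ℕ → R} {a b c : ℕ → R} (ha : ∀ n, a n ≠ 0)
    (hu : ∀ n, a n * u (n + 2) = b n * u (n + 1) + c n * u n)
    (hv : ∀ n, a n * v (n + 2) = b n * v (n + 1) + c n * v n)
    (h0 : u 0 = v 0) (h1 : u 1 = v 1) : u = v := by
  funext n
  induction n using Nat.strong_induction_on with
  | _ n ih =>
    match n, ih with
    | 0, _ => exact h0
    | 1, _ => exact h1
    | k + 2, ih =>
      have e0 : u k = v k := ih k (by omega)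
      have e1 : u (k + 1) = v (k + 1) := ih (k + 1) (by omega)
      have := hu k
      rw [e0, e1, ← hv k] at this
      exact mul_left_cancel₀ (ha k) this

/-- **Uniqueness for order 3.** Two sequences solving
`a(n) y(n+3) = b(n) y(n+2) + c(n) y(n+1) + d(n) y(n)` with non-vanishing leading coefficient and the
same three initial values coincide. -/
theorem eq_of_rec₃ [NoZeroDivisors R] {u v : ℕ → R} {a b c d : ℕ → R} (ha : ∀ n, a n ≠ 0)
    (hu : ∀ n, a n * u (n + 3) = b n * u (n + 2) + c n * u (n + 1) + d n * u n)
    (hv : ∀ n, a n * v (n + 3) = b n * v (n + 2) + c n * v (n + 1) + d n * v n)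
    (h0 : u 0 = v 0) (h1 : u 1 = v 1) (h2 : u 2 = v 2) : u = v := by
  funext n
  induction n using Nat.strong_induction_on with
  | _ n ih =>
    match n, ih with
    | 0, _ => exact h0
    | 1, _ => exact h1
    | 2, _ => exact h2
    | k + 3, ih =>
      have e0 : u k = v k := ih k (by omega)
      have e1 : u (k + 1) = v (k + 1) := ih (k + 1) (by omega)
      have e2 : u (k + 2) = v (k + 2) := ih (k + 2) (by omega)
      have := hu k
      rw [e0, e1, e2, ← hv k] at this
      exact mul_left_cancel₀ (ha k) this

end Summit.KontsevichZagierPeriods.Zeta5Search.Certificates
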